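import Summits.Ventures.HSemireg.WedgeHankelRecurrenceHankelDeterminant
import Summits.Ventures.HSemireg.WedgeHankelRecurrenceSymbol
import Mathlib.FieldTheory.Separable

/-!
# Venture HSemireg — THE RANK OF THE SQUARE HANKEL MATRIX OF A RATIONAL CLASS AND HERMITE'S SEPARABILITY CRITERION: for `m` monic of degree `t + 1` and any `a`,
# **`rank (dualSeq m a (i + j))_{i,j ≤ t} = t + 1 − deg gcd(m, a)`** (Kronecker: the rank is the degree of the reduced denominator of `a/m`; N73 gave `det ≠ 0 ⟺ gcd = 1`), and for `a = m′`
# (the power sums ∕ Newton sums class `m′/m`): **`det (dualSeq m m′ (i + j))_{i,j ≤ t} ≠ 0 ⟺ m` is SEPARABLE**, `rank = t + 1 − deg gcd(m, m′)`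
# («HERMITE 1856 ∕ SYLVESTER: the Hankel matrix of the Newton sums `p_0, …, p_{2t}` of a monic `m` of degree `t + 1` is non-singular iff `m` has distinct roots; its rank is `deg (m / gcd(m, m′))`,
# the number of distinct roots in characteristic `0`»)

HONEST FRAMING. Part of the Lean index of the computation cell `pub-hsemireg` (seat p10 gen 31, Sunday typer «UNIFORM-IN-n»).
LINEAR ALGEBRA OF HANKEL (catalecticant) MATRICES and of polynomials over a field ONLY (`EuclideanDomain.gcd`, `Polynomial.Separable`, `Polynomial.derivative`): no variety, no cohomology theory,
no sheaf, no Ext group and no semiregularity map is constructed here; nothing here says that HC / HC_CM / HC_AV holds; no Literature fact is declared or used.  Custodian versions as in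
`WedgeHankelSiegelIdeal` (1/3).  The characteristic-`0` reading «`t + 1 − deg gcd(m, m′)` = number of distinct roots» is dictionary only (in characteristic `p` it fails, e.g. `m = X^p`).

WHAT IS IN THE TREE.  N73 (`WedgeHankelRecurrenceHankelDeterminant`): `hankelSq`, `mulResidueMat`, `det_hankelSq_dualSeq_ne_zero_iff` (`det H_t(a/m) ≠ 0 ⟺ IsCoprime m a`), `det_mulResidueMat_ne_zero_iff`,
`norm_adjoinRoot_mk_ne_zero_iff`; N48 (`WedgeHankelRecurrenceCensusDet`): `rank_hankelSq` (`rank H_t = rank H^{2t}_t`), `rank_hankelSq_eq_iff_det_ne_zero`; N45 (`WedgeHankelRecurrenceSymbol`):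
`rank_hankel1_half_dualSeq_of_factor` (Kronecker, factorised form), `isCoprime_of_gcd_mul`, `natDegree_gcd_eq_zero_of_isCoprime`.  Mathlib: `EuclideanDomain.gcd`, `Polynomial.separable_def`
(`Separable m ↔ IsCoprime m m′`), `Polynomial.monic_mul_leadingCoeff_inv`, `isCoprime_mul_unit_left` ∕ `_right`, `Polynomial.natDegree_eq_zero`, `Polynomial.isUnit_C`.
THIS FILE (namespace `Summit.Ventures.HSemireg.Wedge.HankelOuter` continued; PLAIN on N73 + N45 (+ `Mathlib.FieldTheory.Separable`); 0 definitions):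
* §652 **`rank_hankelSq_dualSeq`** (`rank H_t(dualSeq m a) = t + 1 − deg gcd(m, a)` for `m` monic of degree `t + 1` and ANY `a` — the coprime case by N73's determinant, the non-coprime case by
  cancelling `gcd(m, a)` (N45's factorised Kronecker at `N = 2t`: the reduced denominator has degree `≤ t`)), `rank_hankelSq_dualSeq_lt_iff` (`rank < t + 1 ⟺ ¬ IsCoprime m a`);
  **`det_hankelSq_dualSeq_derivative_ne_zero_iff`** (HERMITE: `det H_t(m′/m) ≠ 0 ⟺ m.Separable`), `rank_hankelSq_dualSeq_derivative` (`rank H_t(m′/m) = t + 1 − deg gcd(m, m′)`),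
  `det_mulResidueMat_derivative_ne_zero_iff` (`det M_{m′} ≠ 0 ⟺ m.Separable`), `norm_adjoinRoot_mk_derivative_ne_zero_iff` (`N_{K[X]/(m) ∕ K}(m′ mod m) ≠ 0 ⟺ m.Separable` — the norm of
  `m′(x)` is `± disc(m)`, dictionary only here).
Nothing Ext-side.  New names only.
-/

open Module Polynomial
open scoped Matrix Polynomial

namespace Summit.Ventures.HSemireg.Wedge.HankelOuter

open Summit.Ventures.HSemireg.Wedge Summit.Ventures.HSemireg.Wedge.Hankel

variable (K : Type*) [Field K]

/-! ## §652. The rank of `H_t(a/m)` and Hermite's separability criterion -/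

/-- **KRONECKER FOR THE SQUARE HANKEL MATRIX: `rank (dualSeq m a (i + j))_{i,j ≤ t} = t + 1 − deg gcd(m, a)`** for `m` monic of degree `t + 1` and any `a` (the degree of the reduced denominator
of the symbol `a/m`). The coprime case is N73 (`det ≠ 0`); otherwise `g = gcd(m, a)` has positive degree, `a/m = (a/g)/(m/g)` with `deg (m/g) ≤ t`, and N45's factorised form of Kronecker's
theorem applies inside the window `[0, 2t]`. -/
theorem rank_hankelSq_dualSeq [DecidableEq K] {t : ℕ} {m : K[X]} (hm : m.Monic) (hmd : m.natDegree = t + 1) (a : K[X]) :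
    (hankelSq K t (dualSeq K m a)).rank = t + 1 - (EuclideanDomain.gcd m a).natDegree := by
  by_cases hcop : IsCoprime m a
  · rw [natDegree_gcd_eq_zero_of_isCoprime K hcop, Nat.sub_zero]
    exact (rank_hankelSq_eq_iff_det_ne_zero K t _).mpr ((det_hankelSq_dualSeq_ne_zero_iff K hm hmd a).mpr hcop)
  · set g := EuclideanDomain.gcd m a with hg
    have hg0 : g ≠ 0 := fun h => hm.ne_zero ((EuclideanDomain.gcd_eq_zero_iff.mp h).1)
    obtain ⟨m₁', hm₁'⟩ : g ∣ m := EuclideanDomain.gcd_dvd_left m a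
    obtain ⟨a₁', ha₁'⟩ : g ∣ a := EuclideanDomain.gcd_dvd_right m a
    have hm₁'0 : m₁' ≠ 0 := fun h => hm.ne_zero (by rw [hm₁', h, mul_zero])
    have hcop' : IsCoprime m₁' a₁' := isCoprime_of_gcd_mul K hg0 hm₁' ha₁'
    -- `g` is not a unit (else `m`, `a` would be coprime), hence has positive degree
    have hgu : ¬ IsUnit g := fun hu => hcop (by rw [hm₁', ha₁']; exact (isCoprime_mul_unit_left hu m₁' a₁').mpr hcop')
    have hgdeg : 1 ≤ g.natDegree := by
      rcases Nat.eq_zero_or_pos g.natDegree with h0 | hpos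
      · obtain ⟨x, hx⟩ := Polynomial.natDegree_eq_zero.mp h0
        have hx0 : x ≠ 0 := fun h => hg0 (by rw [← hx, h, map_zero])
        exact absurd (hx ▸ Polynomial.isUnit_C.mpr (isUnit_iff_ne_zero.mpr hx0)) hgu
      · exact hpos
    -- normalise the quotient `m₁'` to a monic `m₁`, moving its leading coefficient into the common factor
    set u := m₁'.leadingCoeff with hu
    have hu0 : u ≠ 0 := Polynomial.leadingCoeff_ne_zero.mpr hm₁'0
    have hunit : IsUnit (Polynomial.C u⁻¹) := Polynomial.isUnit_C.mpr (Ne.isUnit (inv_ne_zero hu0))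
    have hm₁ : (m₁' * Polynomial.C u⁻¹).Monic := Polynomial.monic_mul_leadingCoeff_inv hm₁'0
    have hCC : Polynomial.C u * Polynomial.C u⁻¹ = 1 := by rw [← Polynomial.C_mul, mul_inv_cancel₀ hu0, Polynomial.C_1]
    have hmg : m = (g * Polynomial.C u) * (m₁' * Polynomial.C u⁻¹) := by
      rw [hm₁']; calc g * m₁' = g * m₁' * (Polynomial.C u * Polynomial.C u⁻¹) := by rw [hCC, mul_one]
        _ = (g * Polynomial.C u) * (m₁' * Polynomial.C u⁻¹) := by ring
    have hag : a = (g * Polynomial.C u) * (a₁' * Polynomial.C u⁻¹) := by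
      rw [ha₁']; calc g * a₁' = g * a₁' * (Polynomial.C u * Polynomial.C u⁻¹) := by rw [hCC, mul_one]
        _ = (g * Polynomial.C u) * (a₁' * Polynomial.C u⁻¹) := by ring
    have hcop₁ : IsCoprime (m₁' * Polynomial.C u⁻¹) (a₁' * Polynomial.C u⁻¹) := (isCoprime_mul_unit_right hunit m₁' a₁').mpr hcop'
    have hdeg : (m₁' * Polynomial.C u⁻¹).natDegree = t + 1 - g.natDegree := by
      rw [Polynomial.natDegree_mul_leadingCoeff_inv _ hm₁'0, ← hmd, hm₁', Polynomial.natDegree_mul hg0 hm₁'0, Nat.add_sub_cancel_left]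
    rw [rank_hankelSq, ← hdeg]
    exact (rank_hankel1_half_dualSeq_of_factor K (N := 2 * t) hm hm₁ hmg hag hcop₁ (by rw [hdeg]; omega)).1

/-- `rank H_t(dualSeq m a) < t + 1 ⟺ ¬ IsCoprime m a` (`m` monic of degree `t + 1`). -/
theorem rank_hankelSq_dualSeq_lt_iff [DecidableEq K] {t : ℕ} {m : K[X]} (hm : m.Monic) (hmd : m.natDegree = t + 1) (a : K[X]) :
    (hankelSq K t (dualSeq K m a)).rank < t + 1 ↔ ¬ IsCoprime m a := by
  rw [← det_hankelSq_dualSeq_ne_zero_iff K hm hmd a, ← rank_hankelSq_eq_iff_det_ne_zero]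
  have h := Matrix.rank_le_height (hankelSq K t (dualSeq K m a))
  omega

/-- **HERMITE'S CRITERION: `det (dualSeq m m′ (i + j))_{i,j ≤ t} ≠ 0 ⟺ m` IS SEPARABLE** (`m` monic of degree `t + 1`; `dualSeq m m′` is the class of the Newton sums `m′/m`; `Separable m ↔
IsCoprime m m′` is Mathlib's definition). Any field. -/
theorem det_hankelSq_dualSeq_derivative_ne_zero_iff [DecidableEq K] {t : ℕ} {m : K[X]} (hm : m.Monic) (hmd : m.natDegree = t + 1) :
    (hankelSq K t (dualSeq K m (derivative m))).det ≠ 0 ↔ m.Separable := by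
  rw [det_hankelSq_dualSeq_ne_zero_iff K hm hmd, Polynomial.separable_def]

/-- **`rank (dualSeq m m′ (i + j))_{i,j ≤ t} = t + 1 − deg gcd(m, m′)`** (`m` monic of degree `t + 1`; in characteristic `0` this is the number of distinct roots of `m` — dictionary only). -/
theorem rank_hankelSq_dualSeq_derivative [DecidableEq K] {t : ℕ} {m : K[X]} (hm : m.Monic) (hmd : m.natDegree = t + 1) :
    (hankelSq K t (dualSeq K m (derivative m))).rank = t + 1 - (EuclideanDomain.gcd m (derivative m)).natDegree :=
  rank_hankelSq_dualSeq K hm hmd (derivative m)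

/-- `det M_{m′} ≠ 0 ⟺ m` is separable (the multiplication matrix of `m′` on `K[X]/(m)`, `m` monic of degree `t + 1`). -/
theorem det_mulResidueMat_derivative_ne_zero_iff [DecidableEq K] {t : ℕ} {m : K[X]} (hm : m.Monic) (hmd : m.natDegree = t + 1) :
    (mulResidueMat K t m (derivative m)).det ≠ 0 ↔ m.Separable := by
  rw [det_mulResidueMat_ne_zero_iff K hm hmd, Polynomial.separable_def]

/-- **`N_{K[X]/(m) ∕ K}(m′ mod m) ≠ 0 ⟺ m` is separable** (`m` monic of degree `t + 1`; the norm of `m′(x)` is `± disc(m)` — dictionary only here). -/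
theorem norm_adjoinRoot_mk_derivative_ne_zero_iff [DecidableEq K] {t : ℕ} {m : K[X]} (hm : m.Monic) (hmd : m.natDegree = t + 1) :
    Algebra.norm K (AdjoinRoot.mk m (derivative m)) ≠ 0 ↔ m.Separable := by
  rw [norm_adjoinRoot_mk_ne_zero_iff K hm hmd, Polynomial.separable_def]

end Summit.Ventures.HSemireg.Wedge.HankelOuter
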